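import Mathlib
import HarnessLib

/-!
# RuelleBand / `AsymptoticCriticalLine`: Hennion's decomposition theorem, Hilbert-space form

Route `RiemannHypothesis/RuelleBand`, crux item stmt-RiemannHypothesis-2063
(`AsymptoticCriticalLine`), line `interior-edge-split`, helper file (`--supports`). Everything is
proved; no definitions.

Informal statement. Let `H` be a complex Hilbert space, `A : H → H` a bounded operator and `w` a
seminorm on `H` such that

* (two-norm / Lasota–Yorke inequality) `‖A f‖ ≤ r ‖f‖ + R w(f)` for all `f`, with `r, R ≥ 0`;
* (compact embedding) the unit ball of `H` is totally bounded for `w`: for every `η > 0` there is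
  a finite set `F ⊆ H` such that every `f` with `‖f‖ ≤ 1` has `w(f - g) < η` for some `g ∈ F`.

Then for every `δ > 0` the operator splits as `A = S + K` with `K` compact (indeed of finite rank)
and `‖S‖ ≤ 2 r + δ`. This is the output step of the quasi-compactness theorem of
Ionescu-Tulcea–Marinescu (Ann. of Math. 52 (1950)) and H. Hennion, "Sur un théorème spectral et
son application aux noyaux lipchitziens", Proc. Amer. Math. Soc. 118 (1993): the essential
spectral radius of `A` is at most `2 r` (and `r` after iterating). We prove the Hilbert-space case,
where the measure-of-noncompactness step of Hennion's argument becomes an orthogonal projection: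
`K := P_V ∘ A` with `V` the (finite-dimensional) span of the images `A f_g` of representatives
`f_g` of the cells of a finite `w`-net of the unit ball, and `‖(A - K) f‖ ≤ ‖A f - A f_g‖ =
‖A (f - f_g)‖ ≤ 2 r + 2 R η` by the Lasota–Yorke inequality, since `‖f - f_g‖ ≤ 2` and
`w(f - f_g) < 2 η`.
-/

noncomputable section

-- D-0017: `Summit.<S>.<S>.…` is the designed namespace of a single-problem summit.
set_option linter.dupNamespace false

namespace Summit.RiemannHypothesis.RiemannHypothesis.Theorems

variable {H : Type} [NormedAddCommGroup H] [InnerProductSpace ℂ H]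

/-- The orthogonal projection of `y` onto `V` is at least as close to `y` as any point of `V`.
[folklore] -/
theorem norm_sub_starProjection_le_of_mem (V : Submodule ℂ H) [V.HasOrthogonalProjection]
    (y : H) {x : H} (hx : x ∈ V) : ‖y - V.starProjection y‖ ≤ ‖y - x‖ := by
  rw [Submodule.starProjection_minimal]
  have hb : BddBelow (Set.range fun z : V => ‖y - (z : H)‖) :=
    ⟨0, Set.forall_mem_range.mpr fun _ => norm_nonneg _⟩
  exact ciInf_le hb ⟨x, hx⟩

/-- A continuous linear map into a finite-dimensional subspace of a complex inner product space,
followed by the inclusion of that subspace, is a compact operator. [folklore] -/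
theorem isCompactOperator_starProjection_comp (V : Submodule ℂ H) [FiniteDimensional ℂ V]
    [V.HasOrthogonalProjection] (A : H →L[ℂ] H) :
    IsCompactOperator (V.starProjection.comp A) := by
  have h1 : IsCompactOperator (V.orthogonalProjectionOnto.comp A) :=
    isCompactOperator_of_locallyCompactSpace_dom _
  exact h1.clm_comp V.subtypeL

/-- The unit-ball form of the operator-norm bound over `ℂ`: if `‖S f‖ ≤ C` whenever `‖f‖ ≤ 1`
(and `0 ≤ C`), then `‖S‖ ≤ C`. [folklore] -/
theorem opNorm_le_of_unit_ball (S : H →L[ℂ] H) {C : ℝ} (hC : 0 ≤ C)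
    (hS : ∀ f : H, ‖f‖ ≤ 1 → ‖S f‖ ≤ C) : ‖S‖ ≤ C :=
  ContinuousLinearMap.opNorm_le_of_unit_norm hC fun f hf => hS f hf.le

/-- **Hennion's decomposition theorem (Hilbert-space form).** A bounded operator `A` on a complex
Hilbert space satisfying a two-norm inequality `‖A f‖ ≤ r ‖f‖ + R w(f)` for a seminorm `w` whose
restriction to the unit ball is totally bounded splits, for every `δ > 0`, as `A = S + K` with `K`
compact and `‖S‖ ≤ 2 r + δ`. [folklore] -/
theorem hennion_decomposition :
    ∀ (H : Type) (_ : NormedAddCommGroup H) (_ : InnerProductSpace ℂ H) (_ : CompleteSpace H) (A : H →L[ℂ] H) (w : Seminorm ℂ H) (r R δ : ℝ), 0 ≤ r → 0 ≤ R → 0 < δ → (∀ f : H, ‖A f‖ ≤ r * ‖f‖ + R * w f) → (∀ η : ℝ, 0 < η → ∃ F : Finset H, ∀ f : H, ‖f‖ ≤ 1 → ∃ g ∈ F, w (f - g) < η) → ∃ S K : H →L[ℂ] H, A = S + K ∧ IsCompactOperator K ∧ ‖S‖ ≤ 2 * r + δ := by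
  intro H _ _ _ A w r R δ hr hR hδ hLY hw
  classical
  -- the mesh of the net
  set η : ℝ := δ / (2 * R + 2) with hη_def
  have h2R : 0 < 2 * R + 2 := by positivity
  have hη : 0 < η := div_pos hδ h2R
  have hRη : R * (2 * η) ≤ δ := by
    have h1 : R * (2 * η) = δ * (2 * R / (2 * R + 2)) := by
      rw [hη_def]; field_simp
    have h2 : 2 * R / (2 * R + 2) ≤ 1 := by
      rw [div_le_one h2R]; linarith
    calc R * (2 * η) = δ * (2 * R / (2 * R + 2)) := h1
      _ ≤ δ * 1 := by gcongr
      _ = δ := mul_one δ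
  obtain ⟨F, hF⟩ := hw η hη
  -- representatives of the cells of the net inside the unit ball
  let rep : H → H := fun g =>
    if h : ∃ f₀ : H, ‖f₀‖ ≤ 1 ∧ w (f₀ - g) < η then h.choose else 0
  have hrep : ∀ g f₀ : H, ‖f₀‖ ≤ 1 → w (f₀ - g) < η → ‖rep g‖ ≤ 1 ∧ w (rep g - g) < η := by
    intro g f₀ h1 h2
    have h : ∃ f₀ : H, ‖f₀‖ ≤ 1 ∧ w (f₀ - g) < η := ⟨f₀, h1, h2⟩
    simp only [rep, dif_pos h]
    exact h.choose_spec
  -- the finite-dimensional range of the compact part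
  let V : Submodule ℂ H := Submodule.span ℂ (↑(F.image fun g => A (rep g)) : Set H)
  haveI : FiniteDimensional ℂ V := FiniteDimensional.span_of_finite ℂ (Finset.finite_toSet _)
  haveI : CompleteSpace V := FiniteDimensional.complete ℂ V
  have hmemV : ∀ g ∈ F, A (rep g) ∈ V := fun g hg =>
    Submodule.subset_span (Finset.mem_coe.mpr (Finset.mem_image_of_mem _ hg))
  let K : H →L[ℂ] H := V.starProjection.comp A
  refine ⟨A - K, K, (sub_add_cancel A K).symm, isCompactOperator_starProjection_comp V A, ?_⟩
  -- the norm bound on the unit ball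
  refine opNorm_le_of_unit_ball (A - K) (by positivity) fun f hf => ?_
  obtain ⟨g, hgF, hg⟩ := hF f hf
  obtain ⟨hrep1, hrep2⟩ := hrep g f hf hg
  -- `f - rep g` is `w`-small and norm-bounded by `2`
  have hw2 : w (f - rep g) < 2 * η := by
    have hsplit : f - rep g = (f - g) + (g - rep g) := by abel
    calc w (f - rep g) = w ((f - g) + (g - rep g)) := by rw [hsplit]
      _ ≤ w (f - g) + w (g - rep g) := map_add_le_add w _ _
      _ = w (f - g) + w (rep g - g) := by rw [map_sub_rev w g (rep g)]
      _ < η + η := add_lt_add hg hrep2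
      _ = 2 * η := by ring
  have hn2 : ‖f - rep g‖ ≤ 2 := by
    calc ‖f - rep g‖ ≤ ‖f‖ + ‖rep g‖ := norm_sub_le f (rep g)
      _ ≤ 1 + 1 := add_le_add hf hrep1
      _ = 2 := by norm_num
  have hA : ‖A f - A (rep g)‖ ≤ 2 * r + δ := by
    rw [← map_sub]
    calc ‖A (f - rep g)‖ ≤ r * ‖f - rep g‖ + R * w (f - rep g) := hLY _
      _ ≤ r * 2 + R * (2 * η) := by
          gcongr
      _ ≤ 2 * r + δ := by linarith
  calc ‖(A - K) f‖ = ‖A f - V.starProjection (A f)‖ := by simp [K]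
    _ ≤ ‖A f - A (rep g)‖ := norm_sub_starProjection_le_of_mem V (A f) (hmemV g hgF)
    _ ≤ 2 * r + δ := hA

end Summit.RiemannHypothesis.RiemannHypothesis.Theorems

end
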